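import Literature.NumberTheory.GaloisRepresentations.InertiaCohomologyFinite
import Mathlib.Data.ZMod.QuotientGroup
import Mathlib.Data.Nat.Factorization.Basic
import HarnessLib

/-!
# The tame chain of index-`p` subgroups of `Γ_K` for Tate's theorem
# (cell `b2b-bsdres`, team n1011, row T-EPC = Tate's local Euler–Poincaré characteristic; seat p04 GEN 8; stage D3b-ii)

HONEST FRAMING (cell `b2b-bsdres`, run/shared/lean/b2b/bsd-rank1-residual/, verbatim in every
file): the goal of the cell is to DELETE the COMBINATION-SHAPED residual classes of the
Birch–Swinnerton-Dyer formula for ALL analytic-rank `≤ 1` elliptic curves over `ℚ` — "full BSD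
formula for every rank `≤ 1` curve in class `C`" assembled STRICTLY from published theorems — so
that the rank-`≤ 1` remainder becomes exactly the CONSTRUCTION-SHAPED classes, which are TYPED
(missing-input `Prop`s), NOT attempted. This is not "finishing BSD". Team n1011 (N10 / N11, the
additive block X4 ∧ `p = 3`): research route; no claim beyond the stated classes; nothing is
booked; no mark / label is changed by this file. Theorems only (no definition, no named fact, no
`sorry`).  (Placement: Summits/GaloisImage with the T-EPC cone.)

## What

* `EPCChain.exists_chain` — group theory: if `Γ/N` is finite and generated by the class of `γ`,
  then for every prime `p` there is a chain `Γ = Δ₀ ≥ Δ₁ ≥ ⋯ ≥ Δ_a ≥ N` of normal subgroups,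
  `Δ_i` the pull-back of `⟨γ̄^{p^i}⟩`, with `[Δ_i : Δ_{i+1}] = p`, `[Γ : Δ_a] = p^a` and
  `p ∤ [Δ_a : N]`;
* `EPCChain.exists_wild_subgroup` — ramification: for an open normal `V ⊴ Γ_K` there is a normal
  `J = I_K^{v₁} ≤ I_K` whose image in `Γ_K/V` is a `p`-group (`absUpperInertia_map_isPGroup`) such
  that **for every open normal `U ⊇ J V` the image of the inertia group `I_K` in `Γ_K/U` has order
  prime to `p`** (`absInertia_map_isCyclic`: `Γ_K → Γ_K/U` kills every `I_K^v`, `v > 0`, because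
  the images of the `I_K^v` in `Γ_K/V` stabilise at `v₁`).

References: J.-P. Serre, *Local Fields* (1979), IV §2 Cor. 1, 3 of Prop. 7 [SerreLocalFields1979];
J.-P. Serre, *Galois Cohomology* (1997), II §5.7 [SerreGaloisCohomology1997].
-/

noncomputable section

open Function Field
open scoped ValuativeRel
open Literature.NumberTheory.GaloisRepresentations

universe u

namespace Summit.BirchSwinnertonDyer.Rank1Residual.GaloisImage

namespace EPCChain

/-! ### The chain in a group with cyclic quotient -/

/-- **Chain of index-`p` normal subgroups above `N` when `Γ/N` is finite cyclic.** If every class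
in `Γ/N` is a power of `γ̄`, `#(Γ/N) = p^a · m` with `p ∤ m`, then `Δ_i = π⁻¹⟨γ̄^{p^i}⟩`
(`0 ≤ i ≤ a`) are normal, `Δ₀ = Γ`, `[Δ_i : Δ_{i+1}] = p`, `[Γ : Δ_a] = p^a`, `[Δ_a : N] = m`.
[folklore] -/
theorem exists_chain {Γ : Type*} [Group Γ] (N : Subgroup Γ) [N.Normal] [Finite (Γ ⧸ N)] (γ : Γ)
    (hγ : ∀ q : Γ ⧸ N, ∃ i : ℕ, q = (QuotientGroup.mk γ : Γ ⧸ N) ^ i) {p : ℕ} (hp : p.Prime) :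
    ∃ (a : ℕ) (Δ : ℕ → Subgroup Γ), Δ 0 = ⊤ ∧ (∀ i, N ≤ Δ i) ∧ (∀ i, (Δ i).Normal) ∧
      (∀ i, Δ (i + 1) ≤ Δ i) ∧ (∀ i < a, (Δ (i + 1)).relIndex (Δ i) = p) ∧
      (Δ a).index = p ^ a ∧ ¬ p ∣ N.relIndex (Δ a) := by
  classical
  set g : Γ ⧸ N := QuotientGroup.mk γ with hgdef
  set f : Γ →* Γ ⧸ N := QuotientGroup.mk' N with hfdef
  have hf : Surjective f := QuotientGroup.mk'_surjective N
  have hmem : ∀ q : Γ ⧸ N, q ∈ Subgroup.zpowers g := fun q => by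
    obtain ⟨i, rfl⟩ := hγ q
    exact Subgroup.npow_mem_zpowers g i
  have hord : orderOf g = Nat.card (Γ ⧸ N) := orderOf_eq_card_of_forall_mem_zpowers hmem
  have hn0 : Nat.card (Γ ⧸ N) ≠ 0 := Nat.card_pos.ne'
  obtain ⟨a, m, hpm, hnm⟩ := Nat.exists_eq_pow_mul_and_not_dvd hn0 p hp.one_lt.ne'
  -- all elements of `Γ/N` commute
  have hcomm : ∀ x y : Γ ⧸ N, x * y = y * x := fun x y => by
    obtain ⟨i, rfl⟩ := hγ x
    obtain ⟨j, rfl⟩ := hγ y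
    rw [← pow_add, ← pow_add, add_comm]
  -- the chain downstairs
  set D : ℕ → Subgroup (Γ ⧸ N) := fun i => Subgroup.zpowers (g ^ p ^ i) with hDdef
  have hDnormal : ∀ i, (D i).Normal := fun i =>
    ⟨fun x hx y => by rwa [hcomm y x, mul_inv_cancel_right]⟩
  have hDcard : ∀ i ≤ a, Nat.card (D i) = p ^ (a - i) * m := fun i hi => by
    have hdvd : p ^ i ∣ orderOf g := by
      rw [hord, hnm]; exact (pow_dvd_pow p hi).mul_right m
    rw [hDdef, Nat.card_zpowers, orderOf_pow_of_dvd (pow_ne_zero i hp.ne_zero) hdvd, hord, hnm,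
      ← pow_mul_pow_sub p hi, mul_assoc, Nat.mul_div_cancel_left _ (pow_pos hp.pos i)]
  have hDindex : ∀ i ≤ a, (D i).index = p ^ i := fun i hi => by
    have h := (D i).index_mul_card
    rw [hDcard i hi, hnm, ← pow_mul_pow_sub p hi, mul_assoc] at h
    exact Nat.eq_of_mul_eq_mul_right (Nat.mul_pos (pow_pos hp.pos _) (Nat.pos_of_ne_zero fun hm => by
      rw [hm, mul_zero] at hnm; exact hn0 hnm)) h
  have hDle : ∀ i, D (i + 1) ≤ D i := fun i => by
    rw [hDdef, Subgroup.zpowers_le, pow_succ, pow_mul]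
    exact Subgroup.npow_mem_zpowers _ p
  -- pull back
  refine ⟨a, fun i => (D i).comap f, ?_, fun i x hx => ?_, fun i => Subgroup.Normal.comap (hDnormal i) f,
    fun i => Subgroup.comap_mono (hDle i), fun i hi => ?_, ?_, ?_⟩
  · -- `Δ 0 = ⊤`
    have : D 0 = ⊤ := by
      rw [eq_top_iff]
      intro q _
      rw [hDdef]
      simpa only [pow_zero, pow_one] using hmem q
    change (D 0).comap f = ⊤
    rw [this, Subgroup.comap_top]
  · -- `N ≤ Δ i`
    rw [Subgroup.mem_comap]
    have : f x = 1 := by rw [hfdef, QuotientGroup.mk'_apply, QuotientGroup.eq_one_iff]; exact hx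
    rw [this]
    exact one_mem _
  · -- `[Δ i : Δ (i+1)] = p`
    rw [Subgroup.relIndex_comap, Subgroup.map_comap_eq_self_of_surjective hf]
    have h := Subgroup.relIndex_mul_index (hDle i)
    rw [hDindex i hi.le, hDindex (i + 1) hi, pow_succ] at h
    exact Nat.eq_of_mul_eq_mul_left (pow_pos hp.pos i) (by rw [mul_comm]; exact h)
  · -- `[Γ : Δ a] = p^a`
    rw [Subgroup.index_comap_of_surjective _ hf, hDindex a le_rfl]
  · -- `[Δ a : N] = m`
    have hNle : N ≤ (D a).comap f := fun x hx => by
      rw [Subgroup.mem_comap]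
      have : f x = 1 := by rw [hfdef, QuotientGroup.mk'_apply, QuotientGroup.eq_one_iff]; exact hx
      rw [this]
      exact one_mem _
    have h := Subgroup.relIndex_mul_index hNle
    rw [Subgroup.index_comap_of_surjective _ hf, hDindex a le_rfl, Subgroup.index_eq_card, hnm,
      mul_comm (p ^ a) m] at h
    have hrel : N.relIndex ((D a).comap f) = m := Nat.eq_of_mul_eq_mul_right (pow_pos hp.pos a) h
    change ¬ p ∣ N.relIndex ((D a).comap f)
    rw [hrel]
    exact hpm

/-! ### The wild subgroup `J = I_K^{v₁}` -/

variable (K : Type u) [Field K] [ValuativeRel K] [TopologicalSpace K] [IsNonarchimedeanLocalField K]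

/-- **The wild subgroup attached to an open normal `V ⊴ Γ_K`.** There is a normal subgroup
`J = I_K^{v₁} ≤ I_K` of `Γ_K` whose image in `Γ_K/V` is a `p`-group (`p` the residue
characteristic) and such that for every open normal `U ⊴ Γ_K` containing `J` and `V` the image of
the inertia group `I_K` in `Γ_K/U` has order prime to `p` (the images of the ramification groups
`I_K^v`, `v > 0`, in the finite group `Γ_K/V` stabilise at some `v₁ > 0`, so `Γ_K → Γ_K/U` is tame).
[cite: SerreLocalFields1979, IV §2 Cor. 1 and Cor. 3 of Prop. 7] -/
theorem exists_wild_subgroup (V : Subgroup (absoluteGaloisGroup K)) [hVn : V.Normal]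
    (hVo : IsOpen (V : Set (absoluteGaloisGroup K))) :
    ∃ J : Subgroup (absoluteGaloisGroup K), J.Normal ∧ J ≤ absInertia K ∧
      IsPGroup (ringChar 𝓀[K]) (J.map (QuotientGroup.mk' V)) ∧
      ∀ (U : Subgroup (absoluteGaloisGroup K)) [U.Normal], IsOpen (U : Set (absoluteGaloisGroup K)) →
        J ≤ U → V ≤ U →
        (Nat.card ((absInertia K).map (QuotientGroup.mk' U))).Coprime (ringChar 𝓀[K]) := by
  classical
  haveI : CompactSpace (absoluteGaloisGroup K) := absoluteGaloisGroup_compactSpace K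
  haveI : Finite (absoluteGaloisGroup K ⧸ V) := Subgroup.quotient_finite_of_isOpen V hVo
  haveI : DiscreteTopology (absoluteGaloisGroup K ⧸ V) := QuotientGroup.discreteTopology hVo
  let π : absoluteGaloisGroup K →ₜ* (absoluteGaloisGroup K ⧸ V) :=
    ⟨QuotientGroup.mk' V, QuotientGroup.continuous_mk⟩
  -- the images of `I^v` in `Γ/V` stabilise near `0` (as in `InertiaCohomologyFinite`)
  let Pv : ℝ → Subgroup (absoluteGaloisGroup K ⧸ V) := fun v => (absUpperInertia K v).map π.toMonoidHom
  have hanti : ∀ {v v'}, v ≤ v' → Pv v' ≤ Pv v := fun h =>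
    Subgroup.map_mono (absUpperInertia_antitone_holds K h)
  obtain ⟨v₁, hv₁, hstab⟩ : ∃ v₁ : ℝ, 0 < v₁ ∧ ∀ v, 0 < v → v ≤ v₁ → Pv v = Pv v₁ := by
    let a : ℕ →o Subgroup (absoluteGaloisGroup K ⧸ V) := ⟨fun n => Pv (1 / (n + 1)), fun m n hmn => hanti (by
      apply one_div_le_one_div_of_le (by positivity); exact_mod_cast Nat.succ_le_succ hmn)⟩
    obtain ⟨n₀, hn₀⟩ := WellFoundedGT.monotone_chain_condition a
    refine ⟨1 / (n₀ + 1), by positivity, fun v hv hle => le_antisymm ?_ (hanti hle)⟩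
    obtain ⟨n, hn⟩ := exists_nat_one_div_lt hv
    have h1 : (1 : ℝ) / ((max n n₀ : ℕ) + 1) ≤ v := by
      refine le_trans ?_ hn.le
      apply one_div_le_one_div_of_le (by positivity)
      exact_mod_cast Nat.succ_le_succ (le_max_left n n₀)
    calc Pv v ≤ Pv (1 / ((max n n₀ : ℕ) + 1)) := hanti h1
      _ = a (max n n₀) := rfl
      _ = a n₀ := (hn₀ _ (le_max_right _ _)).symm
      _ = Pv (1 / (n₀ + 1)) := rfl
  set J : Subgroup (absoluteGaloisGroup K) := absUpperInertia K v₁ with hJdef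
  haveI : J.Normal := absUpperInertia_normal K v₁
  have hJI : J ≤ absInertia K := absUpperInertia_le_absInertia_holds K v₁
  refine ⟨J, inferInstance, hJI, absUpperInertia_map_isPGroup_holds K (absoluteGaloisGroup K ⧸ V) π hv₁,
    fun U _ hUo hJU hVU => ?_⟩
  haveI : DiscreteTopology (absoluteGaloisGroup K ⧸ U) := QuotientGroup.discreteTopology hUo
  let f : absoluteGaloisGroup K →ₜ* (absoluteGaloisGroup K ⧸ U) := ⟨QuotientGroup.mk' U, QuotientGroup.continuous_mk⟩
  have hkill : ∀ v : ℝ, 0 < v → ∀ σ ∈ absUpperInertia K v, f σ = 1 := by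
    intro v hv σ hσ
    change QuotientGroup.mk' U σ = 1
    rw [QuotientGroup.mk'_apply, QuotientGroup.eq_one_iff]
    rcases le_total v v₁ with hle | hle
    · have hmemP : π.toMonoidHom σ ∈ Pv v₁ := hstab v hv hle ▸ Subgroup.mem_map_of_mem _ hσ
      obtain ⟨y, hy, hyσ⟩ := Subgroup.mem_map.1 hmemP
      have hyσ' : y⁻¹ * σ ∈ V := by
        change QuotientGroup.mk' V y = QuotientGroup.mk' V σ at hyσ
        rwa [QuotientGroup.mk'_apply, QuotientGroup.mk'_apply, QuotientGroup.eq] at hyσ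
      rw [show σ = y * (y⁻¹ * σ) by group]
      exact U.mul_mem (hJU hy) (hVU hyσ')
    · exact hJU (absUpperInertia_antitone_holds K hle hσ)
  exact (absInertia_map_isCyclic_holds K (absoluteGaloisGroup K ⧸ U) f hkill).2

end EPCChain

end Summit.BirchSwinnertonDyer.Rank1Residual.GaloisImage

end
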